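import Summits.QuantumFields.QCD.Theses.SpectralDefectExtinction
import Literature.Barriers.QuantumFields.WilsonDeterminantSign
import Literature.Analysis.Matrix.CoerciveCombesThomas
import Literature.MathematicalPhysics.QuantumLattice.WilsonDiracRangeOne
import Literature.MathematicalPhysics.QuantumLattice.MobilityGap
import Literature.MathematicalPhysics.QuantumFieldTheory.QCDPhaseQuenched

/-!
# Stub `stub_hermitianWilsonCombesThomas` of line `weyl-window`
# (crux `SpectralDefectExtinction.ExtinctionBuildsQCD`, item stmt-QuantumFields-8968)

**Combes–Thomas for the Hermitian Wilson–Dirac operator OFF THE REAL AXIS.**  For every torus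
`(ℤ/L)⁴`, every `SU(3)` gauge field `U`, every bare mass `m₀` and every real `η` with `|η| ≥ 1`,
the resolvent `(H_W(U,m₀) − iη)⁻¹` of `H_W = Γ₅ D_W(U, m₀, 1)` has colour–spin entries bounded by
`‖(H_W − iη)⁻¹(p, q)‖ ≤ 2 · exp(−‖p.1 − q.1‖₁ / 400)` in the periodic taxi distance — uniformly in
`U`, `m₀`, `L` and `|η| ≥ 1`.  This is the deterministic large-`|η|` input of the Aizenman–Graf
representation `π·sgn(H) = PV∫_{|η|≤Y} (H − iη)⁻¹ dη + 2·arctan(H/Y)` used by the composed stub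
`stub_fermiProjectorScreening` (the small-`|η|` segment is the probabilistic `stub_bandScreening`).

Proof: the abstract coercive Combes–Thomas bound `Literature.Analysis.Matrix.coercive_combes_thomas`
on `QuarkIdx L` with the site pseudo-metric `torusTaxiDist`, applied to `A = H_W − iη·1`:
RANGE ONE and off-site row/column sums `≤ 96` are those of `D_W` (the chirality signs have modulus
one and the diagonal shift is invisible off the site-diagonal;
`Literature…WilsonDiracRangeOne`), and the COERCIVITY FLOOR `Σ‖(A v)_i‖² ≥ η² Σ‖v_i‖² ≥ Σ‖v_i‖²`
is the identity `‖(H − iη)v‖² = ‖Hv‖² + η²‖v‖²` for Hermitian `H` (the cross term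
`Re(iη⟨Hv, v⟩)` vanishes because `⟨Hv, v⟩` is real).  With `g = 1`, `h = 96`, `θ = 1/400`:
`96(e^θ − 1) ≤ 192 θ < 1/2`.

References (prose): Combes–Thomas, Comm. Math. Phys. 34 (1973) 251; Aizenman–Graf, J. Phys. A 31
(1998) 6783; Aizenman–Warzel, GSM 168, §10.3 and Ch. 13.
-/

noncomputable section

namespace Summit.QuantumFields.QCD.Cruxes.ExtinctionBuildsQCD.WeylWindow

open scoped BigOperators ComplexConjugate
open Matrix Finset
open Literature.MathematicalPhysics.QuantumLattice Literature.MathematicalPhysics.QuantumFieldTheory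
  Literature.Probability.LatticeModels

/-! ## The coercivity floor of `H − iη` for a Hermitian `H` -/

section Floor

variable {n : Type*} [Fintype n] [DecidableEq n]

omit [DecidableEq n] in
/-- For a Hermitian `H`, the scalar `⟨Hv, v⟩ = Σ conj((Hv)_i) v_i` is real (equal to its own
conjugate). -/
theorem star_dotProduct_mulVec_self_real {H : Matrix n n ℂ} (hH : H.IsHermitian) (v : n → ℂ) :
    star (star (H *ᵥ v) ⬝ᵥ v) = star (H *ᵥ v) ⬝ᵥ v := by
  have h1 : star (H *ᵥ v) ⬝ᵥ v = star v ⬝ᵥ (H *ᵥ v) := by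
    conv_lhs => rw [star_mulVec, ← dotProduct_mulVec, hH.eq]
  have h2 : star v ⬝ᵥ (H *ᵥ v) = star (star (H *ᵥ v) ⬝ᵥ v) := star_dotProduct v (H *ᵥ v)
  rw [← h2, h1]

omit [DecidableEq n] in
/-- `Σ‖a_i − c b_i‖² = Σ‖a_i‖² + ‖c‖² Σ‖b_i‖² − 2 Re(c · Σ conj(a_i) b_i)`. -/
theorem sum_norm_sq_sub_mul (a b : n → ℂ) (c : ℂ) :
    ∑ i, ‖a i - c * b i‖ ^ 2 =
      ∑ i, ‖a i‖ ^ 2 + ‖c‖ ^ 2 * ∑ i, ‖b i‖ ^ 2 - 2 * (c * (star a ⬝ᵥ b)).re := by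
  have hterm : ∀ i, ‖a i - c * b i‖ ^ 2 =
      ‖a i‖ ^ 2 + ‖c‖ ^ 2 * ‖b i‖ ^ 2 - 2 * (c * (star (a i) * b i)).re := by
    intro i
    rw [← Complex.normSq_eq_norm_sq, ← Complex.normSq_eq_norm_sq, ← Complex.normSq_eq_norm_sq,
      ← Complex.normSq_eq_norm_sq, Complex.normSq_sub, Complex.normSq_mul]
    have : (a i * conj (c * b i)).re = (c * (star (a i) * b i)).re := by
      rw [← Complex.conj_re (a i * conj (c * b i)), map_mul, Complex.conj_conj, Complex.star_def]
      ring_nf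
    rw [this]
  simp only [hterm]
  rw [Finset.sum_sub_distrib, Finset.sum_add_distrib, ← Finset.mul_sum, ← Finset.mul_sum]
  simp only [dotProduct, Pi.star_apply, Finset.mul_sum, Complex.re_sum]

/-- **Coercivity floor off the real axis**: for Hermitian `H` and real `η`,
`η² Σ‖v_i‖² ≤ Σ‖((H − iη·1) v)_i‖²`. -/
theorem sq_mul_sum_norm_sq_le_of_isHermitian {H : Matrix n n ℂ} (hH : H.IsHermitian) (η : ℝ)
    (v : n → ℂ) :
    η ^ 2 * ∑ i, ‖v i‖ ^ 2 ≤ ∑ i, ‖((H - ((η : ℂ) * Complex.I) • (1 : Matrix n n ℂ)) *ᵥ v) i‖ ^ 2 := by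
  have hAv : ∀ i, ((H - ((η : ℂ) * Complex.I) • (1 : Matrix n n ℂ)) *ᵥ v) i =
      (H *ᵥ v) i - ((η : ℂ) * Complex.I) * v i := by
    intro i
    rw [sub_mulVec, smul_mulVec, one_mulVec, Pi.sub_apply, Pi.smul_apply, smul_eq_mul]
  simp only [hAv]
  rw [sum_norm_sq_sub_mul]
  -- the cross term vanishes: `⟨Hv, v⟩` is real, `iη` is imaginary
  set S : ℂ := star (H *ᵥ v) ⬝ᵥ v with hS
  have hSreal : S.im = 0 := by
    have h := congrArg Complex.im (star_dotProduct_mulVec_self_real hH v)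
    rw [← hS, Complex.star_def, Complex.conj_im] at h
    linarith
  have hcross : (((η : ℂ) * Complex.I) * S).re = 0 := by
    simp [Complex.mul_re, hSreal]
  have hc : ‖(η : ℂ) * Complex.I‖ ^ 2 = η ^ 2 := by
    rw [norm_mul, Complex.norm_I, mul_one, Complex.norm_real, Real.norm_eq_abs, sq_abs]
  rw [hcross, hc, mul_zero, sub_zero]
  have : 0 ≤ ∑ i, ‖(H *ᵥ v) i‖ ^ 2 := Finset.sum_nonneg fun i _ => by positivity
  linarith

end Floor

/-! ## The Wilson instance -/

section Wilson

variable {L : ℕ} [NeZero L]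

/-- Entries of `H_W(U)` have the moduli of the entries of `D_W(U)` (the chirality signs `±1`). -/
theorem ct_norm_hW_apply (U : GaugeConfig 4 L SU3) (m₀ : ℝ) (p q : TorusSite 4 L × Fin 3 × Fin 4) :
    ‖(spinorLift gammaFive * wilsonDirac (fundamentalRep (Fin 3)) U m₀ 1 : Matrix (TorusSite 4 L × Fin 3 × Fin 4) (TorusSite 4 L × Fin 3 × Fin 4) ℂ) p q‖ =
      ‖wilsonDirac (fundamentalRep (Fin 3)) U m₀ 1 p q‖ := by
  rw [spinorLift_gammaFive_eq_diagonal, diagonal_mul, norm_mul]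
  have h1 : ‖(![1, 1, -1, -1] : Fin 4 → ℂ) p.2.2‖ = 1 := by
    rcases p with ⟨x, a, α⟩
    fin_cases α <;> simp
  rw [h1, one_mul]

/-- Off the site-diagonal the shifted Hermitian Wilson operator has the entries of `H_W`, whose
moduli are those of `D_W`. -/
theorem norm_hW_sub_smul_apply_of_ne (U : GaugeConfig 4 L SU3) (m₀ : ℝ) (c : ℂ)
    {p q : TorusSite 4 L × Fin 3 × Fin 4} (hpq : p ≠ q) :
    ‖(spinorLift gammaFive * wilsonDirac (fundamentalRep (Fin 3)) U m₀ 1 - c • 1 :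
        Matrix (TorusSite 4 L × Fin 3 × Fin 4) (TorusSite 4 L × Fin 3 × Fin 4) ℂ) p q‖ =
      ‖wilsonDirac (fundamentalRep (Fin 3)) U m₀ 1 p q‖ := by
  rw [Matrix.sub_apply, Matrix.smul_apply, one_apply_ne hpq, smul_zero, sub_zero, ct_norm_hW_apply]

/-- **Stub `stub_hermitianWilsonCombesThomas` — Combes–Thomas for `H_W − iη`, `|η| ≥ 1`.**  For
every torus, every `SU(3)` field `U`, every bare mass `m₀` and every real `η` with `1 ≤ |η|`:
`‖(Γ₅ D_W(U,m₀,1) − iη)⁻¹ (p, q)‖ ≤ 2 exp(−‖p.1 − q.1‖₁/400)` for all colour–spin indices. -/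
theorem stub_hermitianWilsonCombesThomas :
    ∀ (L : ℕ) [NeZero L] (U : GaugeConfig 4 L SU3) (m₀ η : ℝ), 1 ≤ |η| →
      ∀ (p q : TorusSite 4 L × Fin 3 × Fin 4),
        ‖((spinorLift gammaFive * wilsonDirac (fundamentalRep (Fin 3)) U m₀ 1 -
            ((η : ℂ) * Complex.I) • 1)⁻¹ :
            Matrix (TorusSite 4 L × Fin 3 × Fin 4) (TorusSite 4 L × Fin 3 × Fin 4) ℂ) p q‖ ≤
          2 * Real.exp (-((torusTaxiDist p.1 q.1 : ℝ) / 400)) := by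
  intro L _ U m₀ η hη p q
  set H : Matrix (TorusSite 4 L × Fin 3 × Fin 4) (TorusSite 4 L × Fin 3 × Fin 4) ℂ :=
    spinorLift gammaFive * wilsonDirac (fundamentalRep (Fin 3)) U m₀ 1 with hHdef
  set A : Matrix (TorusSite 4 L × Fin 3 × Fin 4) (TorusSite 4 L × Fin 3 × Fin 4) ℂ :=
    H - ((η : ℂ) * Complex.I) • 1 with hAdef
  have hρ : ∀ g : SU3, fundamentalRep (Fin 3) g ∈ Matrix.unitaryGroup (Fin 3) ℂ :=
    fun g => fundamentalRep_mem_unitaryGroup g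
  -- off-site entries of `A` are entries of `H_W`, with the moduli of `D_W`
  have hoff : ∀ p q : TorusSite 4 L × Fin 3 × Fin 4, p ≠ q →
      ‖A p q‖ = ‖wilsonDirac (fundamentalRep (Fin 3)) U m₀ 1 p q‖ :=
    fun p q hpq => norm_hW_sub_smul_apply_of_ne U m₀ _ hpq
  -- range one in the taxi distance of the sites
  have hrange : ∀ p q : TorusSite 4 L × Fin 3 × Fin 4, A p q ≠ 0 → torusTaxiDist p.1 q.1 ≤ 1 := by
    intro p q h
    by_cases hpq : p = q
    · rw [hpq, torusTaxiDist_self]; exact zero_le_one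
    · refine torusTaxiDist_le_one_of_wilsonDirac_ne_zero (fundamentalRep (Fin 3)) hρ U m₀ p q ?_
      intro h0
      exact h (norm_eq_zero.1 (by rw [hoff p q hpq, h0, norm_zero]))
  -- off-site row and column sums `≤ 96`
  have hrow : ∀ p, ∑ q ∈ univ.filter (fun q : TorusSite 4 L × Fin 3 × Fin 4 => torusTaxiDist p.1 q.1 ≠ 0),
      ‖A p q‖ ≤ 96 := by
    intro p
    calc _ = ∑ q ∈ univ.filter (fun q : TorusSite 4 L × Fin 3 × Fin 4 => torusTaxiDist p.1 q.1 ≠ 0),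
          ‖wilsonDirac (fundamentalRep (Fin 3)) U m₀ 1 p q‖ := by
          refine Finset.sum_congr rfl fun q hq => hoff p q ?_
          rintro rfl
          exact (Finset.mem_filter.1 hq).2 (torusTaxiDist_self _)
      _ ≤ 32 * (3 : ℕ) := wilsonDirac_rowSum_torusTaxiDist_le (fundamentalRep (Fin 3)) hρ U m₀ p
      _ = 96 := by norm_num
  have hcol : ∀ q, ∑ p ∈ univ.filter (fun p : TorusSite 4 L × Fin 3 × Fin 4 => torusTaxiDist p.1 q.1 ≠ 0),
      ‖A p q‖ ≤ 96 := by
    intro q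
    calc _ = ∑ p ∈ univ.filter (fun p : TorusSite 4 L × Fin 3 × Fin 4 => torusTaxiDist p.1 q.1 ≠ 0),
          ‖wilsonDirac (fundamentalRep (Fin 3)) U m₀ 1 p q‖ := by
          refine Finset.sum_congr rfl fun p hp => hoff p q ?_
          rintro rfl
          exact (Finset.mem_filter.1 hp).2 (torusTaxiDist_self _)
      _ ≤ 32 * (3 : ℕ) := wilsonDirac_colSum_torusTaxiDist_le (fundamentalRep (Fin 3)) hρ U m₀ q
      _ = 96 := by norm_num
  -- the floor with `g = 1`
  have hfloor : ∀ v : TorusSite 4 L × Fin 3 × Fin 4 → ℂ,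
      (1 : ℝ) ^ 2 * ∑ i, ‖v i‖ ^ 2 ≤ ∑ i, ‖(A *ᵥ v) i‖ ^ 2 := by
    intro v
    -- `H_W` is Hermitian (barrier file `WilsonDeterminantSign`; = the landed `hW_isHermitian`)
    have h1 := sq_mul_sum_norm_sq_le_of_isHermitian
      (Literature.Barriers.QuantumFields.WilsonDeterminant.isHermitian_hermitianWilsonDirac _
        (fun g => fundamentalRep_mem_unitaryGroup g) U m₀ 1) η v
    have hN : 0 ≤ ∑ i, ‖v i‖ ^ 2 := Finset.sum_nonneg fun i _ => by positivity
    have hη2 : 1 ≤ η ^ 2 := by nlinarith [abs_nonneg η, sq_abs η]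
    calc (1 : ℝ) ^ 2 * ∑ i, ‖v i‖ ^ 2 ≤ η ^ 2 * ∑ i, ‖v i‖ ^ 2 := by
          rw [one_pow, one_mul]; exact le_mul_of_one_le_left hN hη2
      _ ≤ _ := h1
  -- the rate `θ = 1/400`: `96 (e^θ − 1) ≤ 1/2`
  have hθ : (96 : ℝ) * (Real.exp (1 / 400) - 1) ≤ 1 / 2 := by
    have h1 := Real.abs_exp_sub_one_le (x := 1 / 400) (by norm_num)
    rw [abs_of_nonneg (by norm_num : (0 : ℝ) ≤ 1 / 400),
      abs_of_nonneg (by linarith [Real.add_one_le_exp (1 / 400 : ℝ)])] at h1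
    linarith
  obtain ⟨-, hB⟩ := Literature.Analysis.Matrix.coercive_combes_thomas
    (fun p q : TorusSite 4 L × Fin 3 × Fin 4 => torusTaxiDist p.1 q.1)
    (fun p => torusTaxiDist_self p.1) (fun p q => torusTaxiDist_comm p.1 q.1)
    (fun p q r => torusDistOne_triangle (Ls := fun _ : Fin 4 => L) p.1 q.1 r.1)
    A hrange 96 hrow hcol 1 (1 / 400) one_pos (by norm_num) hfloor hθ
  have h := hB p q
  rw [div_one] at h
  refine h.trans (le_of_eq ?_)
  congr 2
  ring

end Wilson

end Summit.QuantumFields.QCD.Cruxes.ExtinctionBuildsQCD.WeylWindow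

end
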